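import Summits.BirchSwinnertonDyer.Rank1Residual.X11b.KolyvaginShaAtPrimeOfGross1991
import Summits.BirchSwinnertonDyer.Rank1Residual.X11b.Three.KolyvaginShaThreeBSDpClause
import Literature.NumberTheory.EllipticCurves.GrossLMS1991.HeegnerEulerSystemCongruenceImageFree
import HarnessLib

/-!
# `Ш(E/ℚ)[p^∞]` finite for EVERY odd prime `p` and EVERY `(E, p) ∈ ClassX11b W p` with `ρ̄_{E,p}`
# onto — clause (ii) of `BSD(E, p)` — from SEVEN NAMED published facts and nothing else
# (Kolyvagin in kernel form at a multiplicative prime: no (KN_p), no `(K, y_K)`, no `p = 3`)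

Cell `b2b-bsdres`, team x11b3 (N8/O2 = X11b @ 3); seat x11b3-p2 GEN 54 (unit claimed D-0075 →
BSD:K2/P4 «Kolyvagin-in-kernel»).  Summit-side THEOREM-ONLY file (no definition, no named fact,
no `sorry`); `K : Type`; a general odd prime `p`.

HONEST FRAMING (cell `b2b-bsdres`, run/shared/lean/b2b/bsd-rank1-residual/, verbatim in every
file): the goal of the cell is to DELETE the COMBINATION-SHAPED residual classes of the
Birch–Swinnerton-Dyer formula for ALL analytic-rank `≤ 1` elliptic curves over `ℚ` — "full BSD
formula for every rank `≤ 1` curve in class `C`" assembled STRICTLY from published theorems — so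
that the rank-`≤ 1` remainder becomes exactly the CONSTRUCTION-SHAPED classes, which are TYPED
(missing-input `Prop`s), NOT attempted.  This is not "finishing BSD".  Nothing here is booked; no
mark / label / count / tier moves; X11b @ `p` stays OPEN / CONSTRUCTION-SHAPED (clause (ii) of
`BSDp W p` is `Ш[p^∞]` finite; clause (iii), the `p`-part of the formula, is NOT touched).

WHAT THIS FILE DOES.  The seat's class-level clause-(ii) ENDs were so far at `p = 3` only
(`X11b/Three/KolyvaginShaThreeRat{Discharged,OfProp37,OfGross1991}`: the (KN₃) road to the
receptacle input needed `p = 3`-specific Kodaira–Néron bookkeeping and the `3`-specific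
`d_K ∉ {−3, −4}` lemma).  With the receptacle input [GZ86, III (3.1)] taken BY NAME
(`KolyvaginHloc.hGZ_of_gross1991E0`, this GEN) the generic-prime K-side END
`KolyvaginDischarged.sha_primary_finite_at_of_gross1991E0_of_prop37` (`X11b/KolyvaginShaAtPrimeOfGross1991`,
this GEN) has NO prime-specific hypothesis left, so the descent to `ℚ` and the removal of the
`(K, y_K)` datum go through at EVERY odd prime `p`: (1) `res : Ш(E/ℚ) → Ш(E_K/K)` is injective on
`p`-primary parts for `[K : ℚ] = 2` prime to `p` (tree `KolyvaginAssembly.sha_primary_finite_of_baseChange_of_coprime`);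
(2) for `(E, p) ∈ ClassX11b W p` (`r_an = 1`, `p ≠ 2`, `p ‖ N`, `ρ̄_{E,p}` irreducible) a
Hoffstein–Luo Heegner field `K` with `d_K` odd, `d_K < −4` (hence `d_K ∉ {−3, −4}`) and
`L(E^{d_K}, 1) ≠ 0` exists (`exists_admissibleField_of_rootNumber_eq_neg_one`, sign `−1` from
`r_an = 1` by `rootNumber_eq_neg_one_pow_analyticRank_of_exists_isNewformOf`), a Heegner point on it
(`exists_maninDatum_of_odd`), non-torsion by Gross–Zagier (`not_isOfFinAddOrder_of_heegner_of_analyticRank_eq_one`);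
`¬ CM` from `mult(p)`.  HEADLINE (honest): `finite_primaryComponent_sha_of_classX11b_of_surj_of_namedFacts`
— for EVERY odd prime `p` and EVERY `E/ℚ` (globally minimal `W`) with `(E, p) ∈ ClassX11b W p` and
`Surj W p` (`ρ̄_{E,p}` onto): `Ш(E/ℚ)[p^∞]` is FINITE — clause (ii) of `BSDp W p` verbatim —
CONDITIONAL on SEVEN NAMED PUBLISHED FACTS of the tree and NOTHING ELSE: `gross_zagier` (∀),
`hasEntireLFunction_rat`, `exists_isNewformOf`, `HoffsteinLuo1997_exists_twist_L_one_ne_zero`,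
`mazur_not_dvd_maninConstant_of_odd`, `GrossLMS1991.prop37_2_reductionCongruence` (∀ `K`, at `p`; or
its CLOSED image-free sibling `prop37_2_frobeniusCongruence`, primed form),
`Gross1991_heegnerPoint_sub_ratTorsion_mem_E0`; no `(K, y_K)`, no (KN_p), no inline hypothesis.
What it is NOT: it is Kolyvagin's finiteness theorem for the `p`-primary part in KERNEL form modulo
its printed INPUTS (the Eichler–Shimura congruence, [GZ86 III (3.1)], Gross–Zagier, modularity,
Hoffstein–Luo, Mazur's Manin constant) — the named facts `kolyvagin` / `Kolyvagin1990_padicValNat_card_sha_le`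
(Kolyvagin's theorem as a CITED statement) are neither used nor discharged; none of the seven facts
is discharged here; a conditional result (D-0014 named facts), not an unconditional theorem;
nothing booked; no mark / count / tier moves.  At `p = 3` it specialises to this GEN's
`Three.KolyvaginDischarged.finite_primaryComponent_sha_three_of_classX11b_of_surj_of_namedFacts`.

## What is proved

* `KolyvaginDischarged.finite_primaryComponent_sha_of_gross1991E0_rat_of_prop37` — ℚ-side with
  `(K, y_K)`: `Ш(E/ℚ)[p^∞]` finite at one odd surjective `p`, modulo the two named facts at `p` + `hN`.
* `KolyvaginDischarged.pow_smul_sha_rat_primary_eq_zero_of_gross1991E0_rat_of_prop37` — ℚ-side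
  annihilator with `(K, y_K)`: `p^{m+1} ∤ y_K ⟹ p^{m} · Ш(E/ℚ)[p^∞] = 0`, same footing.
* `KolyvaginDischarged.primaryComponent_sha_eq_bot_of_gross1991E0_rat_of_not_dvd_of_prop37` —
  `p ∤ y_K ⟹ Ш(E/ℚ)[p^∞] = 0` (Gross 1991 Prop. 2.1 (2) over `ℚ`), same footing.
* `KolyvaginDischarged.finite_primaryComponent_sha_of_classX11b_of_surj_of_namedFacts` — the
  class-level END at EVERY odd prime: SEVEN named facts, nothing else.
* `KolyvaginDischarged.finite_primaryComponent_sha_of_classX11b_of_surj_of_namedFacts'` — the same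
  keyed to the CLOSED image-free sibling `GrossLMS1991.prop37_2_frobeniusCongruence`.

## References

* [GrossLMS1991] B. H. Gross, LMS LNS 153 (1991), §1 (p. 235), §2 (p. 237), Thm. 1.3 (2), §3 Prop.
  3.7 (2) (p. 240), Prop. 5.3, §6 Prop. 6.2 (1) and its proof (p. 245).
* [McCallumLMS1991] W. G. McCallum, same volume, §1 Theorem (Kolyvagin).
* [GrossZagier1986Heegner] Invent. Math. 84 (1986), I (6.3), III (3.1) (p. 256).
* [Miller2011LMS] Def. 1.1 (ii).  [HoffsteinLuo1997] Theorem (§1).  [SerreGaloisCohomology1997]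
  I.§2.4.  [Nekovar2007] Prop. 4.9, 4.13 (ii).  [SilvermanATAEC1994] Thm. II.6.4.  [Mazur1978] Manin constant.

presearch: `lean search 'finite_primaryComponent_sha_of_classX11b'` → none at a general prime before
this GEN (the tree's class-level clause-(ii) ENDs from Kolyvagin INPUTS are `p = 3` only; at general
`p` only via the CITED fact `kolyvagin`, e.g. `X11b.finite_sha_baseChange_of_heegner`); parents =
the tree theorems named above; [corpus: book:editornd-l-functions-arithmetic p0222:L1, p0217:L19–L22];
nothing minted.
-/

noncomputable section

open scoped Classical
open WeierstrassCurve Field NumberField IsDedekindDomain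
open Literature.NumberTheory.EllipticCurves Literature.NumberTheory.GaloisRepresentations
open Literature.NumberTheory.EllipticCurves.Rank1Residual
open Literature.NumberTheory.EllipticCurves.RingClassField
open Literature.NumberTheory.EllipticCurves.ModularForms
open Literature.NumberTheory.DiophantineGeometry Literature.NumberTheory.DiophantineGeometry.TateAlgorithm
open Literature.NumberTheory.EllipticCurves.GrossLMS1991 (prop37_2_reductionCongruence
  prop37_2_frobeniusCongruence prop37_2_reductionCongruence_of_frobeniusCongruence)
open Summit.BirchSwinnertonDyer.Rank1Residual.X11b.KolyvaginAssembly

namespace Summit.BirchSwinnertonDyer.Rank1Residual.X11b.KolyvaginDischarged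

-- `K : Type`: the tree's ring-class class field theory is universe `0`.
variable {K : Type} [Field K] [NumberField K] {N : ℕ} {W : WeierstrassCurve ℚ}

/-- **`Ш(E/ℚ)[p^∞]` finite at ONE odd surjective prime `p`, given `(K, y_K)` — clause (ii) of
`BSDp W p` VERBATIM — NO Kodaira–Néron hypothesis — modulo the TWO NAMED facts
`GrossLMS1991.prop37_2_reductionCongruence N W K p` and `Gross1991_heegnerPoint_sub_ratTorsion_mem_E0`.**
The K-side END `sha_primary_finite_at_of_gross1991E0_of_prop37` (`Ш(E/K)[p^∞]` finite) descended
along `res : Ш(E/ℚ) → Ш(E_K/K)`, injective on `p`-primary parts because `[K : ℚ] = 2` (`hK.1`) is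
prime to the odd prime `p` (`sha_primary_finite_of_baseChange_of_coprime`).  Binders VERBATIM the
K-side END's; for `E = W/ℚ` globally minimal without CM at `N = N_E`, `K` imaginary quadratic
Heegner with `d_K ∉ {−3, −4}`, `P` a non-torsion Heegner point, `p` odd with `ρ̄_{E,p}` onto:
`Finite (AddCommGroup.primaryComponent W.sha p)`.  CONDITIONAL on EXACTLY the two named facts
(PUBLISHED, NOT discharged) + `hN`; nothing booked; no mark / count / tier moves.
[cite: Miller2011LMS, Def. 1.1 (ii)] [cite: McCallumLMS1991, §1 Theorem (Kolyvagin)]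
[cite: GrossLMS1991, §3 Prop. 3.7 (2) (p. 240), §6 Prop. 6.2 (1) (p. 245)] [cite: SerreGaloisCohomology1997, I.§2.4] -/
theorem finite_primaryComponent_sha_of_gross1991E0_rat_of_prop37 [NeZero N]
    [W.IsGloballyMinimal] {p : ℕ} (hp : p.Prime) (hp2 : p ≠ 2)
    (hN : ∀ [W.IsElliptic], N = W.conductorNorm ℤ)
    (hE0 : Gross1991_heegnerPoint_sub_ratTorsion_mem_E0)
    (hγ : prop37_2_reductionCongruence N W K p) :
    ∀ [W.IsElliptic] (_hE : ¬ W.HasCM) (_hK : IsImaginaryQuadratic K)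
      (_hD : NumberField.discr K ≠ -3 ∧ NumberField.discr K ≠ -4)
      (_hH : SatisfiesHeegnerHypothesis N K)
      {P : (W.baseChange K).toAffine.Point} (_hP : IsHeegnerPoint N W K P)
      (_hnt : ¬ IsOfFinAddOrder P) (_hρ : W.HasSurjectiveModNGaloisRep p),
      Finite (AddCommGroup.primaryComponent W.sha p) := by
  intro _ hE hK hD hH P hP hnt hρ
  haveI : Algebra.IsQuadraticExtension ℚ K := ⟨hK.1⟩
  have hcop : p.Coprime (Module.finrank ℚ K) := by
    rw [hK.1]; exact (Nat.coprime_primes hp Nat.prime_two).mpr hp2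
  exact (sha_primary_finite_of_baseChange_of_coprime W K hcop
    (sha_primary_finite_at_of_gross1991E0_of_prop37 hp hp2 hN hE0 hγ hE hK hD hH hP hnt hρ)).to_subtype

/-- **At ONE odd surjective prime `p`, given `(K, y_K)`: `p^{m} · Ш(E/ℚ)[p^∞] = 0` for every `m`
with `p^{m+1} ∤ y_K` in `E(K)` — NO Kodaira–Néron hypothesis — modulo the TWO NAMED facts.**  The
K-side annihilator `pow_smul_sha_primary_eq_zero_at_of_gross1991E0_of_prop37` descended along `res`
(`pow_smul_sha_primary_eq_zero_of_baseChange_of_coprime`, `[K : ℚ] = 2` prime to `p`).  Binders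
VERBATIM the K-side END's, conclusion over `c : Ш(E/ℚ)`.  CONDITIONAL on EXACTLY the two named
facts + `hN`; nothing booked; no mark.
[cite: McCallumLMS1991, §1 Theorem (Kolyvagin), Lemma 5.1] [cite: GrossLMS1991, §3 Prop. 3.7 (2), §6 Prop. 6.2 (1)]
[cite: SerreGaloisCohomology1997, I.§2.4] -/
theorem pow_smul_sha_rat_primary_eq_zero_of_gross1991E0_rat_of_prop37 [NeZero N]
    [W.IsGloballyMinimal] {p : ℕ} (hp : p.Prime) (hp2 : p ≠ 2)
    (hN : ∀ [W.IsElliptic], N = W.conductorNorm ℤ)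
    (hE0 : Gross1991_heegnerPoint_sub_ratTorsion_mem_E0)
    (hγ : prop37_2_reductionCongruence N W K p) :
    ∀ [W.IsElliptic] (_hE : ¬ W.HasCM) (_hK : IsImaginaryQuadratic K)
      (_hD : NumberField.discr K ≠ -3 ∧ NumberField.discr K ≠ -4)
      (_hH : SatisfiesHeegnerHypothesis N K)
      {P : (W.baseChange K).toAffine.Point} (_hP : IsHeegnerPoint N W K P)
      (_hnt : ¬ IsOfFinAddOrder P) (_hρ : W.HasSurjectiveModNGaloisRep p) {m : ℕ}
      (_hm : ∀ Q : (W.baseChange K).toAffine.Point, p ^ (m + 1) • Q ≠ P) (c : W.sha),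
      (∃ j : ℕ, p ^ j • c = 0) → p ^ m • c = 0 := by
  intro _ hE hK hD hH P hP hnt hρ m hm
  haveI : Algebra.IsQuadraticExtension ℚ K := ⟨hK.1⟩
  have hcop : p.Coprime (Module.finrank ℚ K) := by
    rw [hK.1]; exact (Nat.coprime_primes hp Nat.prime_two).mpr hp2
  exact pow_smul_sha_primary_eq_zero_of_baseChange_of_coprime W K hcop
    (pow_smul_sha_primary_eq_zero_at_of_gross1991E0_of_prop37 hp hp2 hN hE0 hγ hE hK hD hH hP hnt hρ hm)

/-- **At ONE odd surjective prime `p`, given `(K, y_K)`: `p ∤ y_K` in `E(K)` ⟹ `Ш(E/ℚ)[p^∞] = 0`** (as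
Mathlib's `AddCommGroup.primaryComponent W.sha p = ⊥`) — NO Kodaira–Néron hypothesis — the case
`m = 0` of the ℚ-side annihilator (Gross 1991 Prop. 2.1 (2), descended to `ℚ`); modulo the TWO NAMED
facts + `hN`; nothing booked; no mark.
[cite: GrossLMS1991, §2 Prop. 2.1 (2), §3 Prop. 3.7 (2), §6 Prop. 6.2 (1)] [cite: McCallumLMS1991, §1 Theorem (Kolyvagin)]
[cite: SerreGaloisCohomology1997, I.§2.4] -/
theorem primaryComponent_sha_eq_bot_of_gross1991E0_rat_of_not_dvd_of_prop37 [NeZero N]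
    [W.IsGloballyMinimal] {p : ℕ} (hp : p.Prime) (hp2 : p ≠ 2)
    (hN : ∀ [W.IsElliptic], N = W.conductorNorm ℤ)
    (hE0 : Gross1991_heegnerPoint_sub_ratTorsion_mem_E0)
    (hγ : prop37_2_reductionCongruence N W K p) :
    ∀ [W.IsElliptic] (_hE : ¬ W.HasCM) (_hK : IsImaginaryQuadratic K)
      (_hD : NumberField.discr K ≠ -3 ∧ NumberField.discr K ≠ -4)
      (_hH : SatisfiesHeegnerHypothesis N K)
      {P : (W.baseChange K).toAffine.Point} (_hP : IsHeegnerPoint N W K P)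
      (_hnt : ¬ IsOfFinAddOrder P) (_hρ : W.HasSurjectiveModNGaloisRep p)
      (_h1 : ∀ Q : (W.baseChange K).toAffine.Point, p • Q ≠ P),
      AddCommGroup.primaryComponent W.sha p = ⊥ := by
  intro _ hE hK hD hH P hP hnt hρ h1
  refine eq_bot_iff.mpr fun c hc ↦ ?_
  have h := pow_smul_sha_rat_primary_eq_zero_of_gross1991E0_rat_of_prop37 hp hp2 hN hE0 hγ hE hK hD hH
    hP hnt hρ (m := 0) (fun Q ↦ by simpa using h1 Q) c ((AddCommGroup.mem_primaryComponent).mp hc)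
  simpa using h

/-! ### The class-level END at every odd prime: no `(K, y_K)`, no (KN_p), SEVEN named facts -/

/-- **For EVERY odd prime `p`: on the class X11b @ `p` with `ρ̄_{E,p}` onto, `Ш(E/ℚ)[p^∞]` is finite —
clause (ii) of `BSD(E, p)` (`BSDp W p`) VERBATIM — from SEVEN NAMED PUBLISHED FACTS and nothing
else: NO `(K, y_K)` hypothesis, NO inline cite-only input, NO Kodaira–Néron sub-class, NO `p = 3`.**
Data: the sign is `−1` (`r_an = 1`, `rootNumber_eq_neg_one_pow_analyticRank_of_exists_isNewformOf`,
`hnf`); a Hoffstein–Luo Heegner field `K` with `d_K` odd, `d_K < −4` and `L(E^{d_K}, 1) ≠ 0`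
(`exists_admissibleField_of_rootNumber_eq_neg_one`; `hnf`, `hHL`); a Heegner point `y_K` on it
(`exists_maninDatum_of_odd`; `hnf`, `hMaz`), non-torsion by Gross–Zagier
(`not_isOfFinAddOrder_of_heegner_of_analyticRank_eq_one`; `hGZ`, `hmod`); `¬ CM` from `mult(p)`
(Silverman ATAEC II.6.4); then `finite_primaryComponent_sha_of_gross1991E0_rat_of_prop37` at that `K`
(`N = N_E`).  For EVERY odd prime `p` and EVERY `E/ℚ` (globally minimal `W`) with
`(E, p) ∈ ClassX11b W p` (`r_an = 1`, `p ≠ 2`, `p ‖ N`, `ρ̄_{E,p}` irreducible) and `Surj W p`: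
`Finite (AddCommGroup.primaryComponent W.sha p)`.  CONDITIONAL on EXACTLY the named facts
{`gross_zagier` (∀ `N W K`), `hasEntireLFunction_rat`, `exists_isNewformOf`,
`HoffsteinLuo1997_exists_twist_L_one_ne_zero`, `mazur_not_dvd_maninConstant_of_odd`,
`GrossLMS1991.prop37_2_reductionCongruence` (∀ `K`, at `p`), `Gross1991_heegnerPoint_sub_ratTorsion_mem_E0`}
— all PUBLISHED, citation-tagged `def … : Prop`s of `Literature/`, none discharged here — + `hS`.
Kolyvagin's theorem as a CITED statement (`kolyvagin`, `Kolyvagin1990_padicValNat_card_sha_le`) is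
NOT among them: this is the finiteness half of McCallum 1991 §1 Theorem (Kolyvagin) for the
`p`-primary part at a multiplicative surjective prime, in kernel form modulo its printed inputs.  A
conditional result (D-0014 named facts), not an unconditional theorem; clause (iii) of `BSDp W p`
untouched; nothing booked; no mark / count / tier moves.
[cite: Miller2011LMS, Def. 1.1 (ii)] [cite: HoffsteinLuo1997, Theorem (§1)]
[cite: GrossZagier1986Heegner, I (6.3) and III (3.1)] [cite: McCallumLMS1991, §1 Theorem (Kolyvagin)]
[cite: GrossLMS1991, §3 Prop. 3.7 (2) (p. 240), §6 Prop. 6.2 (1) (p. 245), §1 (p. 235), §2 (p. 237)]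
[cite: SilvermanATAEC1994, Thm. II.6.4] -/
theorem finite_primaryComponent_sha_of_classX11b_of_surj_of_namedFacts [W.IsElliptic]
    [W.IsGloballyMinimal] [NeZero (W.conductorNorm ℤ)] {p : ℕ} [Fact p.Prime] (hX : ClassX11b W p)
    (hS : Surj W p)
    -- published inputs (named facts of the tree)
    (hGZ : ∀ (N : ℕ) [NeZero N] (W : WeierstrassCurve ℚ) (K : Type) [Field K] [NumberField K],
      gross_zagier N W K)
    (hmod : hasEntireLFunction_rat) (hnf : exists_isNewformOf)
    (hHL : HoffsteinLuo1997_exists_twist_L_one_ne_zero) (hMaz : mazur_not_dvd_maninConstant_of_odd)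
    (hE0 : Gross1991_heegnerPoint_sub_ratTorsion_mem_E0)
    -- Gross 1991 Prop. 3.7 (2) AT `p`, BY NAME, for every number field `K`
    (hγ : ∀ (K : Type) [Field K] [NumberField K],
      prop37_2_reductionCongruence (W.conductorNorm ℤ) W K p) :
    Finite (AddCommGroup.primaryComponent W.sha p) := by
  obtain ⟨hr, hp2, hmult, hirr⟩ := id hX
  have hp : p.Prime := Fact.out
  -- the sign of the functional equation is `−1` (modularity, `r_an = 1`)
  have hw : W.rootNumber = -1 := by
    rw [WeierstrassCurve.rootNumber_eq_neg_one_pow_analyticRank_of_exists_isNewformOf hnf W, hr]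
    norm_num
  -- a Hoffstein–Luo Heegner field with `d_K` odd, `d_K < -4`, `L(E^{d_K}, 1) ≠ 0`
  obtain ⟨K, _, _, hK, -, hlt, hHN, -, hLt⟩ :=
    exists_admissibleField_of_rootNumber_eq_neg_one hnf hHL W hw p
  have hD : NumberField.discr K ≠ -3 ∧ NumberField.discr K ≠ -4 := ⟨by omega, by omega⟩
  -- a Heegner point on it, non-torsion by Gross–Zagier
  obtain ⟨Dt, H, ι, P, hP, -⟩ := exists_maninDatum_of_odd hnf hMaz
    integral_neronScaling_of_isGloballyMinimal_holds W p (W.conductorNorm ℤ) K rfl hp2 hmult hirr hK hHN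
  have hPinf : ¬ IsOfFinAddOrder P :=
    not_isOfFinAddOrder_of_heegner_of_analyticRank_eq_one W _ K Dt H ι P (hGZ _ W K) hmod hr hK hHN
      hLt hP
  have hE : ¬ W.HasCM := fun hCM ↦ W.not_hasMultiplicativeReductionAtPrime_of_hasCM hCM p hmult
  exact finite_primaryComponent_sha_of_gross1991E0_rat_of_prop37 (N := W.conductorNorm ℤ) hp hp2
    (@fun _ ↦ rfl) hE0 (hγ K) hE hK hD hHN ⟨Dt, H, ι, hP⟩ hPinf hS

/-- **The same class-level END at every odd prime, keyed to the CLOSED image-free print of the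
congruence** — `GrossLMS1991.prop37_2_frobeniusCongruence` (Gross 1991 Prop. 3.7 (2) = Nekovář 2007
Prop. 4.9 / 4.13 (ii) for `X_0(N)`), which implies `prop37_2_reductionCongruence N W K p` at every
`(N, W, K, p)` (`prop37_2_reductionCongruence_of_frobeniusCongruence`).  For EVERY odd prime `p` and
EVERY `E/ℚ` (globally minimal `W`) with `(E, p) ∈ ClassX11b W p` and `Surj W p`:
`Finite (AddCommGroup.primaryComponent W.sha p)` — clause (ii) of `BSDp W p` — CONDITIONAL on EXACTLY
SEVEN CLOSED NAMED PUBLISHED FACTS of `Literature/` {`gross_zagier` (∀), `hasEntireLFunction_rat`,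
`exists_isNewformOf`, `HoffsteinLuo1997_exists_twist_L_one_ne_zero`, `mazur_not_dvd_maninConstant_of_odd`,
`prop37_2_frobeniusCongruence`, `Gross1991_heegnerPoint_sub_ratTorsion_mem_E0`} and nothing else;
none discharged here; a conditional result (D-0014), not an unconditional theorem; clause (iii)
untouched; nothing booked; no mark / count / tier moves.
[cite: Miller2011LMS, Def. 1.1 (ii)] [cite: Nekovar2007, Prop. 4.9 and Prop. 4.13 (ii)]
[cite: GrossLMS1991, §3 Prop. 3.7 (2) (p. 240), §6 Prop. 6.2 (1) (p. 245)] [cite: HoffsteinLuo1997, Theorem (§1)]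
[cite: GrossZagier1986Heegner, I (6.3) and III (3.1)] [cite: McCallumLMS1991, §1 Theorem (Kolyvagin)] -/
theorem finite_primaryComponent_sha_of_classX11b_of_surj_of_namedFacts' [W.IsElliptic]
    [W.IsGloballyMinimal] [NeZero (W.conductorNorm ℤ)] {p : ℕ} [Fact p.Prime] (hX : ClassX11b W p)
    (hS : Surj W p)
    -- published inputs (named facts of the tree)
    (hGZ : ∀ (N : ℕ) [NeZero N] (W : WeierstrassCurve ℚ) (K : Type) [Field K] [NumberField K],
      gross_zagier N W K)
    (hmod : hasEntireLFunction_rat) (hnf : exists_isNewformOf)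
    (hHL : HoffsteinLuo1997_exists_twist_L_one_ne_zero) (hMaz : mazur_not_dvd_maninConstant_of_odd)
    (hE0 : Gross1991_heegnerPoint_sub_ratTorsion_mem_E0) (hγ : prop37_2_frobeniusCongruence) :
    Finite (AddCommGroup.primaryComponent W.sha p) :=
  finite_primaryComponent_sha_of_classX11b_of_surj_of_namedFacts hX hS hGZ hmod hnf hHL hMaz hE0
    (fun K _ _ ↦ prop37_2_reductionCongruence_of_frobeniusCongruence hγ (W.conductorNorm ℤ) W K p)

end Summit.BirchSwinnertonDyer.Rank1Residual.X11b.KolyvaginDischarged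

end
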